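import Mathlib
import Literature.Computability.AlgebraicComplexity.NewtonPolygonTauProductBounds
import Summits.ValiantsHypothesis.ValiantsHypothesis.Theorems.NewtonUnitEquationsDissociatedUniformTotalsLawStaircase
import Summits.ValiantsHypothesis.ValiantsHypothesis.Theorems.NewtonUnitEquationsDissociatedUniformTotalsLawDominance
import HarnessLib

/-!
# Crux `NewtonUnitEquations.DissociatedUniform` (stmt-ValiantsHypothesis-5905): the `n = 3` totals law — BOX WINDOWS
# (unions of translated `m₁ × m₂` windows of a doubly indexed point family have `O((#translates + area)·log)` hull vertices)

Memo `Cruxes/DissociatedUniform/NOTES-t1g17.md` §4; the two-dimensional analogue of `…TotalsLawIntervalUnionLinear` §2 (windows of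
ONE length of a point SEQUENCE reduce, block by block, to staircases), built on `…TotalsLawDominance` (dominance sums = 2D staircases,
`Stair.ncard_extremePoints_domPts_le`).  For a doubly indexed family `b : ℕ × ℕ → ℝ²`, translations `v i` (`i : ι`) and BOX windows
`[l₁ i, l₁ i + m₁) × [l₂ i, l₂ i + m₂)` of one shape with corners `l₁ i < N₁`, `l₂ i < N₂`:
* block decomposition (`boxWindows_eq_biUnion`): cut both index axes into blocks of lengths `m₁`, `m₂`; a window with corner in block
  `(t₁, t₂)` meets the four blocks `(t₁ + p₁, t₂ + p₂)`, `p ∈ {0,1}²`, and its part there consists of the block points whose offsets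
  `(c₁, c₂)` satisfy `k₁ ≤ c₁` (suffix, `p₁ = 0`) or `c₁ < k₁` (prefix, `p₁ = 1`) and likewise in the second axis, where
  `(k₁, k₂) = (l₁ mod m₁, l₂ mod m₂)` are the KEYS of the window — so each of the `4 · #blocks` pieces is a DOMINANCE SUM between the
  translates of the block (rows) and the `m₁m₂` block points (columns), for suitable mixed-radix position codes (`rpos₁/cpos₁`,
  `rpos₂/cpos₂`; the second-axis codes are injective as the dominance bound requires, the first-axis codes need not be);
* **`ncard_extremePoints_boxWindows_le`**: `#vert conv ⋃ᵢ (v i + b[box i]) ≤ 16K·(#ι + m₁m₂(N₁/m₁ + 1)(N₂/m₂ + 1))` with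
  `K = Nat.size((2#ι + 2)(m₁ + 1))` — i.e. `O((#ι + (N₁ + m₁)(N₂ + m₂)) · log(#ι·m₁))`.
This is the tool for the BOXES stratum of the union / `n = 3` laws named in memo `NOTES-t1g16.md` §6(v) (position sets
`Z = I₁ × I₂` in a product group, third curves constant on boxes): the cyclic wrapper (the 2D analogue of
`…IntervalUnionLog.unionPts_cycInterval_eq`) is NOT in this file.  Honest label: a planar incidence tool with a logarithm whose
necessity is open; `UnionTotalsLaw C`, `TotalsLawThree C` remain OPEN and are asserted nowhere; nothing here bears on VP ≠ VNP.
[folklore]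
-/

set_option linter.dupNamespace false -- `ValiantsHypothesis.ValiantsHypothesis` (summit = problem) in every name

open Matrix Finset
open scoped BigOperators Pointwise

namespace Summit.ValiantsHypothesis.ValiantsHypothesis.Theorems.NewtonUnitEquationsDissociatedUniform

namespace TotalsLaw

namespace BoxWin

open Literature.Computability.AlgebraicComplexity.KPTT.PlanarMinkowski

variable {ι : Type*} [Fintype ι]

/-! ### Mixed-radix position codes -/

omit [Fintype ι] in
/-- Comparison of mixed-radix codes: `e + (2E+2)r < (E+1) + (2E+2)c ↔ r ≤ c` for `e ≤ E`. [folklore] -/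
theorem code_lt_iff {E e r c : ℕ} (he : e < E + 1) :
    e + (2 * E + 2) * r < (E + 1) + (2 * E + 2) * c ↔ r ≤ c := by
  constructor
  · intro h
    by_contra hc
    have h1 : (2 * E + 2) * (c + 1) ≤ (2 * E + 2) * r := Nat.mul_le_mul_left _ (by omega)
    rw [mul_add, mul_one] at h1
    omega
  · intro h
    have h1 : (2 * E + 2) * r ≤ (2 * E + 2) * c := Nat.mul_le_mul_left _ h
    omega

/-- First-axis row code of the translate `i` (key `k₁ = l₁ i mod m₁`; `p = true` for the prefix piece). -/
noncomputable def rpos₁ (l₁ : ι → ℕ) (m₁ : ℕ) (p : Bool) (i : ι) : ℕ :=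
  (Fintype.equivFin ι i : ℕ) + (2 * Fintype.card ι + 2) * (if p then m₁ - l₁ i % m₁ else l₁ i % m₁)

/-- First-axis column code of the block point with offset code `n` (`c₁ = n mod m₁`). -/
def cpos₁ (ι : Type*) [Fintype ι] (m₁ : ℕ) (p : Bool) (n : ℕ) : ℕ :=
  (Fintype.card ι + 1) + (2 * Fintype.card ι + 2) * (if p then m₁ - 1 - n % m₁ else n % m₁)

/-- Second-axis row code of the translate `i` (key `k₂ = l₂ i mod m₂`, scaled by `m₁`). -/
noncomputable def rpos₂ (l₂ : ι → ℕ) (m₁ m₂ : ℕ) (p : Bool) (i : ι) : ℕ :=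
  (Fintype.equivFin ι i : ℕ) + (2 * Fintype.card ι + 2) * ((if p then m₂ - l₂ i % m₂ else l₂ i % m₂) * m₁)

/-- Second-axis column code of the block point with offset code `n` (`c₂ = n / m₁`); injective in `n < m₁m₂`. -/
def cpos₂ (ι : Type*) [Fintype ι] (m₁ m₂ : ℕ) (p : Bool) (n : ℕ) : ℕ :=
  (Fintype.card ι + 1) + (2 * Fintype.card ι + 2) * (if p then m₁ * m₂ - 1 - n else n)

/-- First-axis relation: suffix `k₁ ≤ c₁` / prefix `c₁ < k₁`. [folklore] -/
theorem rpos₁_lt_cpos₁_iff (l₁ : ι → ℕ) {m₁ : ℕ} (hm₁ : 0 < m₁) (p : Bool) (i : ι) (n : ℕ) :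
    rpos₁ l₁ m₁ p i < cpos₁ ι m₁ p n ↔ (if p then n % m₁ < l₁ i % m₁ else l₁ i % m₁ ≤ n % m₁) := by
  have he := (Fintype.equivFin ι i).isLt
  have hk : l₁ i % m₁ < m₁ := Nat.mod_lt _ hm₁
  have hc : n % m₁ < m₁ := Nat.mod_lt _ hm₁
  unfold rpos₁ cpos₁
  cases p
  · simp only [Bool.false_eq_true, ↓reduceIte]
    exact code_lt_iff (by omega)
  · simp only [↓reduceIte]
    rw [code_lt_iff (by omega)]
    omega

/-- Second-axis relation: suffix `k₂ ≤ c₂` / prefix `c₂ < k₂`, for offset codes `n < m₁m₂`. [folklore] -/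
theorem rpos₂_lt_cpos₂_iff (l₂ : ι → ℕ) {m₁ m₂ : ℕ} (hm₁ : 0 < m₁) (hm₂ : 0 < m₂) (p : Bool) (i : ι) {n : ℕ}
    (hn : n < m₁ * m₂) :
    rpos₂ l₂ m₁ m₂ p i < cpos₂ ι m₁ m₂ p n ↔ (if p then n / m₁ < l₂ i % m₂ else l₂ i % m₂ ≤ n / m₁) := by
  have he := (Fintype.equivFin ι i).isLt
  have hk : l₂ i % m₂ < m₂ := Nat.mod_lt _ hm₂
  unfold rpos₂ cpos₂
  cases p
  · simp only [Bool.false_eq_true, ↓reduceIte]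
    rw [code_lt_iff (by omega)]
    exact (Nat.le_div_iff_mul_le hm₁).symm
  · simp only [↓reduceIte]
    rw [code_lt_iff (by omega), Nat.div_lt_iff_lt_mul hm₁]
    have h1 : (m₂ - l₂ i % m₂) * m₁ = m₁ * m₂ - l₂ i % m₂ * m₁ := by
      rw [Nat.sub_mul, Nat.mul_comm m₂ m₁]
    have h2 : l₂ i % m₂ * m₁ + m₁ ≤ m₁ * m₂ := by
      have := Nat.mul_le_mul_right m₁ (Nat.succ_le_of_lt hk)
      rw [Nat.succ_mul, Nat.mul_comm m₂ m₁] at this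
      exact this
    rw [h1]
    omega

/-- The second-axis row codes are injective. [folklore] -/
theorem rpos₂_injective (l₂ : ι → ℕ) (m₁ m₂ : ℕ) (p : Bool) : Function.Injective (rpos₂ l₂ m₁ m₂ p) := by
  intro i i' h
  unfold rpos₂ at h
  have hi := (Fintype.equivFin ι i).isLt
  have hi' := (Fintype.equivFin ι i').isLt
  have h1 : (Fintype.equivFin ι i : ℕ) = (Fintype.equivFin ι i' : ℕ) := by
    have := congrArg (· % (2 * Fintype.card ι + 2)) h
    simp only [Nat.add_mul_mod_self_left] at this
    rwa [Nat.mod_eq_of_lt (by omega : (Fintype.equivFin ι i : ℕ) < 2 * Fintype.card ι + 2),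
      Nat.mod_eq_of_lt (by omega : (Fintype.equivFin ι i' : ℕ) < 2 * Fintype.card ι + 2)] at this
  exact (Fintype.equivFin ι).injective (Fin.ext h1)

/-- The second-axis column codes are injective on `Fin (m₁ m₂)`. [folklore] -/
theorem cpos₂_injective (ι : Type*) [Fintype ι] (m₁ m₂ : ℕ) (p : Bool) :
    Function.Injective fun n : Fin (m₁ * m₂) => cpos₂ ι m₁ m₂ p (n : ℕ) := by
  intro n n' h
  have hn := n.isLt
  have hn' := n'.isLt
  simp only [cpos₂] at h
  have hM : 0 < 2 * Fintype.card ι + 2 := by omega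
  have h1 : (if p then m₁ * m₂ - 1 - (n : ℕ) else (n : ℕ)) = (if p then m₁ * m₂ - 1 - (n' : ℕ) else (n' : ℕ)) :=
    Nat.eq_of_mul_eq_mul_left hM (Nat.add_left_cancel h)
  apply Fin.ext
  cases p
  · simpa using h1
  · simp only [↓reduceIte] at h1
    omega

/-- The first-axis column codes are `< (2#ι + 2)(m₁ + 1)`. [folklore] -/
theorem cpos₁_lt (m₁ : ℕ) (hm₁ : 0 < m₁) (p : Bool) (n : ℕ) : cpos₁ ι m₁ p n < (2 * Fintype.card ι + 2) * (m₁ + 1) := by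
  unfold cpos₁
  have hc : n % m₁ < m₁ := Nat.mod_lt _ hm₁
  have h1 : (if p then m₁ - 1 - n % m₁ else n % m₁) ≤ m₁ := by cases p <;> simp <;> omega
  have h2 := Nat.mul_le_mul_left (2 * Fintype.card ι + 2) h1
  rw [Nat.mul_succ]
  omega

/-! ### The pieces of the block decomposition -/

/-- The translates whose window corner lies in block `t = (t₁, t₂)`. -/
noncomputable def boxRows (l₁ l₂ : ι → ℕ) (m₁ m₂ : ℕ) (t : ℕ × ℕ) : Finset ι :=
  Finset.univ.filter fun i => l₁ i / m₁ = t.1 ∧ l₂ i / m₂ = t.2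

/-- The piece `p = (p₁, p₂)` (suffix/prefix flags) of block `t`: a dominance sum between the translates of the block and the points
of the block `(t₁ + p₁, t₂ + p₂)`. -/
noncomputable def boxPiece (b : ℕ × ℕ → (Fin 2 → ℝ)) (v : ι → (Fin 2 → ℝ)) (l₁ l₂ : ι → ℕ) (m₁ m₂ : ℕ)
    (tp : (ℕ × ℕ) × (Bool × Bool)) : Finset (Fin 2 → ℝ) :=
  Stair.domPts (boxRows l₁ l₂ m₁ m₂ tp.1) (Finset.univ : Finset (Fin (m₁ * m₂)))
    (rpos₁ l₁ m₁ tp.2.1) (rpos₂ l₂ m₁ m₂ tp.2.2)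
    (fun n => cpos₁ ι m₁ tp.2.1 (n : ℕ)) (fun n => cpos₂ ι m₁ m₂ tp.2.2 (n : ℕ)) v
    fun n => b ((tp.1.1 + if tp.2.1 then 1 else 0) * m₁ + (n : ℕ) % m₁, (tp.1.2 + if tp.2.2 then 1 else 0) * m₂ + (n : ℕ) / m₁)

/-- **Block decomposition of box windows.**  With corners `l₁ i < N₁`, `l₂ i < N₂` and `m₁, m₂ ≥ 1`, the union of the translated
box windows is the union of the `4(N₁/m₁ + 1)(N₂/m₂ + 1)` dominance-sum pieces. [folklore] -/
theorem boxWindows_eq_biUnion (b : ℕ × ℕ → (Fin 2 → ℝ)) (v : ι → (Fin 2 → ℝ)) (l₁ l₂ : ι → ℕ) {m₁ m₂ : ℕ} (hm₁ : 0 < m₁)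
    (hm₂ : 0 < m₂) (N₁ N₂ : ℕ) (hl₁ : ∀ i, l₁ i < N₁) (hl₂ : ∀ i, l₂ i < N₂) :
    (⋃ i, (v i +ᵥ (b '' (Set.Ico (l₁ i) (l₁ i + m₁) ×ˢ Set.Ico (l₂ i) (l₂ i + m₂))))) =
      ((((Finset.range (N₁ / m₁ + 1) ×ˢ Finset.range (N₂ / m₂ + 1)) ×ˢ (Finset.univ : Finset (Bool × Bool))).biUnion
          (boxPiece b v l₁ l₂ m₁ m₂) : Finset (Fin 2 → ℝ)) : Set (Fin 2 → ℝ)) := by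
  classical
  ext y
  simp only [Set.mem_iUnion, Finset.coe_biUnion, Finset.mem_coe]
  constructor
  · rintro ⟨i, hy⟩
    rw [Set.mem_vadd_set] at hy
    obtain ⟨z, ⟨⟨n₁, n₂⟩, hn, rfl⟩, rfl⟩ := hy
    rw [Set.mem_prod, Set.mem_Ico, Set.mem_Ico] at hn
    obtain ⟨⟨hn1a, hn1b⟩, hn2a, hn2b⟩ := hn
    set t₁ := l₁ i / m₁ with ht₁
    set t₂ := l₂ i / m₂ with ht₂
    have hd₁ : t₁ * m₁ + l₁ i % m₁ = l₁ i := by rw [ht₁]; exact Nat.div_add_mod' (l₁ i) m₁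
    have hd₂ : t₂ * m₂ + l₂ i % m₂ = l₂ i := by rw [ht₂]; exact Nat.div_add_mod' (l₂ i) m₂
    have hk₁ : l₁ i % m₁ < m₁ := Nat.mod_lt _ hm₁
    have hk₂ : l₂ i % m₂ < m₂ := Nat.mod_lt _ hm₂
    -- suffix / prefix flags and offsets
    set p₁ : Bool := decide (t₁ * m₁ + m₁ ≤ n₁) with hp₁
    set p₂ : Bool := decide (t₂ * m₂ + m₂ ≤ n₂) with hp₂
    set c₁ := n₁ - (t₁ + if p₁ then 1 else 0) * m₁ with hc₁
    set c₂ := n₂ - (t₂ + if p₂ then 1 else 0) * m₂ with hc₂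
    have hc₁m : c₁ < m₁ := by
      rw [hc₁]; by_cases h : t₁ * m₁ + m₁ ≤ n₁
      · have : p₁ = true := by rw [hp₁]; exact decide_eq_true h
        rw [this]; simp only [↓reduceIte, add_mul, one_mul]; omega
      · have : p₁ = false := by rw [hp₁]; exact decide_eq_false h
        rw [this]; simp only [Bool.false_eq_true, ↓reduceIte, add_zero]; omega
    have hc₂m : c₂ < m₂ := by
      rw [hc₂]; by_cases h : t₂ * m₂ + m₂ ≤ n₂
      · have : p₂ = true := by rw [hp₂]; exact decide_eq_true h
        rw [this]; simp only [↓reduceIte, add_mul, one_mul]; omega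
      · have : p₂ = false := by rw [hp₂]; exact decide_eq_false h
        rw [this]; simp only [Bool.false_eq_true, ↓reduceIte, add_zero]; omega
    have hn₁eq : (t₁ + if p₁ then 1 else 0) * m₁ + c₁ = n₁ := by
      rw [hc₁]; by_cases h : t₁ * m₁ + m₁ ≤ n₁
      · have : p₁ = true := by rw [hp₁]; exact decide_eq_true h
        rw [this]; simp only [↓reduceIte, add_mul, one_mul]; omega
      · have : p₁ = false := by rw [hp₁]; exact decide_eq_false h
        rw [this]; simp only [Bool.false_eq_true, ↓reduceIte, add_zero]; omega
    have hn₂eq : (t₂ + if p₂ then 1 else 0) * m₂ + c₂ = n₂ := by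
      rw [hc₂]; by_cases h : t₂ * m₂ + m₂ ≤ n₂
      · have : p₂ = true := by rw [hp₂]; exact decide_eq_true h
        rw [this]; simp only [↓reduceIte, add_mul, one_mul]; omega
      · have : p₂ = false := by rw [hp₂]; exact decide_eq_false h
        rw [this]; simp only [Bool.false_eq_true, ↓reduceIte, add_zero]; omega
    -- the column code
    have hncode : c₂ * m₁ + c₁ < m₁ * m₂ := by
      have := Nat.mul_le_mul_right m₁ (Nat.succ_le_of_lt hc₂m)
      rw [Nat.succ_mul, Nat.mul_comm m₂ m₁] at this
      omega
    set n : Fin (m₁ * m₂) := ⟨c₂ * m₁ + c₁, hncode⟩ with hn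
    have hnmod : (n : ℕ) % m₁ = c₁ := by
      show (c₂ * m₁ + c₁) % m₁ = c₁
      rw [Nat.add_comm, Nat.add_mul_mod_self_right, Nat.mod_eq_of_lt hc₁m]
    have hndiv : (n : ℕ) / m₁ = c₂ := by
      show (c₂ * m₁ + c₁) / m₁ = c₂
      rw [Nat.add_comm, Nat.add_mul_div_right _ _ hm₁, Nat.div_eq_of_lt hc₁m, zero_add]
    refine ⟨((t₁, t₂), (p₁, p₂)), Finset.mem_product.2 ⟨Finset.mem_product.2
      ⟨Finset.mem_range.2 (Nat.lt_succ_of_le (Nat.div_le_div_right (hl₁ i).le)),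
       Finset.mem_range.2 (Nat.lt_succ_of_le (Nat.div_le_div_right (hl₂ i).le))⟩, Finset.mem_univ _⟩, ?_⟩
    refine Stair.mem_domPts.2 ⟨i, Finset.mem_filter.2 ⟨Finset.mem_univ _, rfl, rfl⟩, n, Finset.mem_univ _, ?_, ?_, ?_⟩
    · -- first-axis relation
      rw [rpos₁_lt_cpos₁_iff l₁ hm₁, hnmod]
      by_cases h : t₁ * m₁ + m₁ ≤ n₁
      · have : p₁ = true := by rw [hp₁]; exact decide_eq_true h
        rw [this]; simp only [↓reduceIte]
        rw [this] at hn₁eq; simp only [↓reduceIte, add_mul, one_mul] at hn₁eq; omega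
      · have : p₁ = false := by rw [hp₁]; exact decide_eq_false h
        rw [this]; simp only [Bool.false_eq_true, ↓reduceIte]
        rw [this] at hn₁eq; simp only [Bool.false_eq_true, ↓reduceIte, add_zero] at hn₁eq; omega
    · -- second-axis relation
      rw [rpos₂_lt_cpos₂_iff l₂ hm₁ hm₂ _ _ hncode, hndiv]
      by_cases h : t₂ * m₂ + m₂ ≤ n₂
      · have : p₂ = true := by rw [hp₂]; exact decide_eq_true h
        rw [this]; simp only [↓reduceIte]
        rw [this] at hn₂eq; simp only [↓reduceIte, add_mul, one_mul] at hn₂eq; omega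
      · have : p₂ = false := by rw [hp₂]; exact decide_eq_false h
        rw [this]; simp only [Bool.false_eq_true, ↓reduceIte]
        rw [this] at hn₂eq; simp only [Bool.false_eq_true, ↓reduceIte, add_zero] at hn₂eq; omega
    · -- the point
      show v i + b (_, _) = v i +ᵥ b (n₁, n₂)
      rw [vadd_eq_add, hnmod, hndiv, hn₁eq, hn₂eq]
  · rintro ⟨⟨⟨t₁, t₂⟩, ⟨p₁, p₂⟩⟩, -, h⟩
    obtain ⟨i, hi, n, -, h1, h2, rfl⟩ := Stair.mem_domPts.1 h
    obtain ⟨-, hit₁, hit₂⟩ := Finset.mem_filter.1 hi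
    simp only at hit₁ hit₂ h1 h2
    have hd₁ : t₁ * m₁ + l₁ i % m₁ = l₁ i := by rw [← hit₁]; exact Nat.div_add_mod' (l₁ i) m₁
    have hd₂ : t₂ * m₂ + l₂ i % m₂ = l₂ i := by rw [← hit₂]; exact Nat.div_add_mod' (l₂ i) m₂
    have hk₁ : l₁ i % m₁ < m₁ := Nat.mod_lt _ hm₁
    have hk₂ : l₂ i % m₂ < m₂ := Nat.mod_lt _ hm₂
    have hc₁ : (n : ℕ) % m₁ < m₁ := Nat.mod_lt _ hm₁
    have hc₂ : (n : ℕ) / m₁ < m₂ := (Nat.div_lt_iff_lt_mul hm₁).2 (Nat.lt_of_lt_of_eq n.isLt (Nat.mul_comm m₁ m₂))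
    rw [rpos₁_lt_cpos₁_iff l₁ hm₁] at h1
    rw [rpos₂_lt_cpos₂_iff l₂ hm₁ hm₂ _ _ n.isLt] at h2
    refine ⟨i, ?_⟩
    rw [Set.mem_vadd_set]
    refine ⟨b ((t₁ + if p₁ then 1 else 0) * m₁ + (n : ℕ) % m₁, (t₂ + if p₂ then 1 else 0) * m₂ + (n : ℕ) / m₁),
      ⟨((t₁ + if p₁ then 1 else 0) * m₁ + (n : ℕ) % m₁, (t₂ + if p₂ then 1 else 0) * m₂ + (n : ℕ) / m₁), ?_, rfl⟩,
      vadd_eq_add _ _⟩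
    rw [Set.mem_prod, Set.mem_Ico, Set.mem_Ico]
    generalize (n : ℕ) % m₁ = c₁ at h1 hc₁ ⊢
    generalize (n : ℕ) / m₁ = c₂ at h2 hc₂ ⊢
    generalize l₁ i % m₁ = k₁ at h1 hd₁ hk₁ ⊢
    generalize l₂ i % m₂ = k₂ at h2 hd₂ hk₂ ⊢
    constructor
    · cases p₁
      · simp only [Bool.false_eq_true, ↓reduceIte, add_zero] at h1 ⊢; constructor <;> omega
      · simp only [↓reduceIte, add_mul, one_mul] at h1 ⊢; constructor <;> omega
    · cases p₂
      · simp only [Bool.false_eq_true, ↓reduceIte, add_zero] at h2 ⊢; constructor <;> omega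
      · simp only [↓reduceIte, add_mul, one_mul] at h2 ⊢; constructor <;> omega

/-- **Box windows: the hull bound.**  `#vert conv ⋃ᵢ (v i + b[box i]) ≤ 16K(#ι + m₁m₂(N₁/m₁ + 1)(N₂/m₂ + 1))`,
`K = Nat.size((2#ι + 2)(m₁ + 1))`. [folklore] -/
theorem ncard_extremePoints_boxWindows_le (b : ℕ × ℕ → (Fin 2 → ℝ)) (v : ι → (Fin 2 → ℝ)) (l₁ l₂ : ι → ℕ) {m₁ m₂ : ℕ}
    (hm₁ : 0 < m₁) (hm₂ : 0 < m₂) (N₁ N₂ : ℕ) (hl₁ : ∀ i, l₁ i < N₁) (hl₂ : ∀ i, l₂ i < N₂) :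
    (Set.extremePoints ℝ (convexHull ℝ
        (⋃ i, (v i +ᵥ (b '' (Set.Ico (l₁ i) (l₁ i + m₁) ×ˢ Set.Ico (l₂ i) (l₂ i + m₂))))))).ncard ≤
      16 * Nat.size ((2 * Fintype.card ι + 2) * (m₁ + 1)) *
        (Fintype.card ι + m₁ * m₂ * ((N₁ / m₁ + 1) * (N₂ / m₂ + 1))) := by
  classical
  set K := Nat.size ((2 * Fintype.card ι + 2) * (m₁ + 1)) with hK
  set B := Finset.range (N₁ / m₁ + 1) ×ˢ Finset.range (N₂ / m₂ + 1) with hB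
  rw [boxWindows_eq_biUnion b v l₁ l₂ hm₁ hm₂ N₁ N₂ hl₁ hl₂]
  refine (ncard_extremePoints_biUnion_le _ _).trans ?_
  have hpiece : ∀ tp ∈ B ×ˢ (Finset.univ : Finset (Bool × Bool)),
      ((convexHull ℝ (boxPiece b v l₁ l₂ m₁ m₂ tp : Set (Fin 2 → ℝ))).extremePoints ℝ).ncard ≤
        4 * K * ((boxRows l₁ l₂ m₁ m₂ tp.1).card + m₁ * m₂) := by
    intro tp _
    have h := Stair.ncard_extremePoints_domPts_le_size (R := boxRows l₁ l₂ m₁ m₂ tp.1)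
      (C := (Finset.univ : Finset (Fin (m₁ * m₂)))) (ρ₁ := rpos₁ l₁ m₁ tp.2.1) (γ₁ := fun n => cpos₁ ι m₁ tp.2.1 (n : ℕ))
      (v := v) (b := fun n : Fin (m₁ * m₂) =>
        b ((tp.1.1 + if tp.2.1 then 1 else 0) * m₁ + (n : ℕ) % m₁, (tp.1.2 + if tp.2.2 then 1 else 0) * m₂ + (n : ℕ) / m₁))
      (rpos₂_injective l₂ m₁ m₂ tp.2.2) (cpos₂_injective ι m₁ m₂ tp.2.2) ((2 * Fintype.card ι + 2) * (m₁ + 1))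
      (fun n _ => cpos₁_lt m₁ hm₁ tp.2.1 (n : ℕ))
    rw [Finset.card_univ, Fintype.card_fin] at h
    exact h
  refine (Finset.sum_le_sum hpiece).trans ?_
  -- sum over pieces: rows of a block are counted 4 times, each block contributes `4 · m₁m₂`
  rw [Finset.sum_product]
  have hrows : ∑ t ∈ B, (boxRows l₁ l₂ m₁ m₂ t).card ≤ Fintype.card ι := by
    rw [← Finset.card_univ, Finset.card_eq_sum_card_fiberwise (s := Finset.univ) (t := B)
      (f := fun i => (l₁ i / m₁, l₂ i / m₂)) (fun i _ => by
        rw [hB, Finset.coe_product]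
        exact Set.mk_mem_prod (Finset.mem_coe.2 (Finset.mem_range.2 (Nat.lt_succ_of_le (Nat.div_le_div_right (hl₁ i).le))))
          (Finset.mem_coe.2 (Finset.mem_range.2 (Nat.lt_succ_of_le (Nat.div_le_div_right (hl₂ i).le)))))]
    refine le_of_eq (Finset.sum_congr rfl fun t _ => ?_)
    unfold boxRows
    congr 1
    ext i
    simp only [Finset.mem_filter, Finset.mem_univ, true_and, Prod.ext_iff]
  have hinner : ∀ t ∈ B, ∑ p ∈ (Finset.univ : Finset (Bool × Bool)),
      4 * K * ((boxRows l₁ l₂ m₁ m₂ (t, p).1).card + m₁ * m₂) = 4 * (4 * K * ((boxRows l₁ l₂ m₁ m₂ t).card + m₁ * m₂)) := by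
    intro t _
    have hc : ∀ p : Bool × Bool, 4 * K * ((boxRows l₁ l₂ m₁ m₂ (t, p).1).card + m₁ * m₂) =
        4 * K * ((boxRows l₁ l₂ m₁ m₂ t).card + m₁ * m₂) := fun p => rfl
    rw [Finset.sum_congr rfl (fun p _ => hc p), Finset.sum_const, Finset.card_univ, smul_eq_mul]
    simp only [Fintype.card_prod, Fintype.card_bool]
  rw [Finset.sum_congr rfl hinner, ← Finset.mul_sum, ← Finset.mul_sum, Finset.sum_add_distrib, Finset.sum_const, smul_eq_mul,
    hB, Finset.card_product, Finset.card_range, Finset.card_range]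
  have := Nat.mul_le_mul_left (16 * K) (Nat.add_le_add_right hrows ((N₁ / m₁ + 1) * (N₂ / m₂ + 1) * (m₁ * m₂)))
  calc 4 * (4 * K * (∑ t ∈ Finset.range (N₁ / m₁ + 1) ×ˢ Finset.range (N₂ / m₂ + 1), (boxRows l₁ l₂ m₁ m₂ t).card +
          (N₁ / m₁ + 1) * (N₂ / m₂ + 1) * (m₁ * m₂)))
      = 16 * K * (∑ t ∈ B, (boxRows l₁ l₂ m₁ m₂ t).card + (N₁ / m₁ + 1) * (N₂ / m₂ + 1) * (m₁ * m₂)) := by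
        rw [hB]; ring
    _ ≤ 16 * K * (Fintype.card ι + (N₁ / m₁ + 1) * (N₂ / m₂ + 1) * (m₁ * m₂)) := this
    _ = 16 * K * (Fintype.card ι + m₁ * m₂ * ((N₁ / m₁ + 1) * (N₂ / m₂ + 1))) := by ring

end BoxWin

end TotalsLaw

end Summit.ValiantsHypothesis.ValiantsHypothesis.Theorems.NewtonUnitEquationsDissociatedUniform
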